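/-
Copyright (c) 2026 the pub-hodgecm-mathlib formalisation cell (harness21).  Prover seat hodgecm-mathlib-K2E3-p20 (g4), HCML Track B «K2-LIT», h413 = `stmt-HodgeConjecture-24833`,
(SC-an) line, road «FC» (lead K2E3-p14 (g4) RULINGS #15 ∕ #18 (R18-3)): the shared index lemma of (FC-D)∕(FC-5) — the Haar mass of the unit filtration `1 + 𝔭ⁿ` relative to `𝒪^×`.  2026-09-04.
-/
import Literature.NumberTheory.Automorphic.LocalFieldHaarBalls            -- ★ `LocalFieldHaar.isHaarMeasure_unitsMeasure` (`d×x = dx∕|x|` is Haar on `Kˣ`), `measure_primePowBall_eq_mul_succ`, `measurableEmbedding_unitsVal`, `isOpenEmbedding_unitsVal`, `normAbs_lt_zpow_iff`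
import Literature.NumberTheory.Automorphic.TateLocalFunctionalEquation    -- ★ `isOpen_unitFiltration`, `one_mem_unitFiltration`; brings ★ `unitFiltration`, `mem_unitFiltration_iff_sub_one_mem`, `secondCountableTopology_units`, `normAbs_eq_one_iff_valuation_eq_one`
import HarnessLib

/-!
# h413 ∕ Track B «K2-LIT», (SC-an) line, road «FC»: THE HAAR MASS OF THE UNIT FILTRATION — `μ'(1 + 𝔭ⁿ⁺¹) ≤ q⁻ⁿ · μ'(𝒪^×)` on `Kˣ`
# (Tate 1950, §2.2–§2.5; Weil 1967, Ch. I §4)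

Cell `pub/hodgecm-mathlib`, crux H413 = `stmt-HodgeConjecture-24833`; THEOREMS ONLY (no `def`, no `instance`, no `notation`, no named-fact hypothesis, no `sorry`); lane
`--supports stmt-HodgeConjecture-24833 --as helper`, count-neutral.  RULING #18 (R18-3): «p20 → `Theorems/K2E3UnitFiltrationMeasure.lean` («`μ'(unitFiltration K n) ≤ C₀ q^{−n}
μ'(𝒪^×)`», S–M) NOW» — the lemma both digit-fibre bounds of (FC-D) (`K2E3UnitsDigitFibre`, K2E5-p17 (g3)) and (FC-5) (K2E2-p13 (g3)) reduce to.

THE MATHEMATICS.  For an additive Haar measure `μ` on the non-archimedean local field `K` (`q = #k_K`): `μ(𝔭ᵏ) = q·μ(𝔭ᵏ⁺¹)` (★ `measure_primePowBall_eq_mul_succ`), hence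
`μ(𝔭ⁿ⁺¹) = q⁻ⁿ μ(𝔭)` and `μ(𝔭) ≤ μ(𝒪 ∖ 𝔭)` (`q ≥ 2`).  The measure `ν = (dx∕|x|)|_{Kˣ}` is a Haar measure on `Kˣ` (★ `isHaarMeasure_unitsMeasure`) and agrees with `μ` on
subsets of the unit sphere (density `1`); `1 + 𝔭ⁿ⁺¹ ⊆ 𝒪^×` has image `⊆ 1 + 𝔭ⁿ⁺¹` (a translate of `𝔭ⁿ⁺¹`) and `𝒪 ∖ 𝔭 ⊆` the image of `𝒪^×`.  Every Haar measure `μ'` on `Kˣ` is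
`c·ν` (Mathlib uniqueness), so **`μ'(U^{n+1}) ≤ q⁻ⁿ·μ'(𝒪^×)`**, `U^m = unitFiltration K m = {|a| = 1, |a − 1| ≤ q⁻ᵐ}`, `𝒪^× = {a : Kˣ | valuation ↑a = 1}` (★ currency of
`TateLocalZetaShells.measure_shell` ∕ `measure_unitSphere_pos`).  (The sharp value is `μ'(U^m) = μ'(𝒪^×)∕((q−1)q^{m−1})`; the inequality is all road FC needs.)

* §1 `unitsMeasure_apply_of_normAbs_eq_one` (`ν T = μ(↑T)` on the unit sphere), `image_unitFiltration_succ_subset` (`↑U^{n+1} ⊆ 1 +ᵥ 𝔭ⁿ⁺¹`), `shell_zero_subset_image_unitSphere`.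
* §2 `measure_primePowBall_succ_le` (`μ(𝔭ⁿ⁺¹) = q⁻ⁿ μ(𝔭)`-type bound), `measure_primePowBall_one_le_shell` (`μ(𝔭) ≤ μ(𝒪 ∖ 𝔭)`).
* §3 HEAD **`measure_unitFiltration_succ_le`**: `μ' (unitFiltration K (n+1)) ≤ ((q : ℝ≥0∞)⁻¹) ^ n * μ' {a : Kˣ | valuation K ↑a = 1}` for EVERY Haar measure `μ'` on `Kˣ`; and
  `unitFiltration_subset_unitSphere`, `measure_smul_unitFiltration_succ_le` (coset form `μ'(a₀·U^{n+1}) ≤ q⁻ⁿ μ'(𝒪^×)`).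

HONEST LABEL.  HC_CM is proved only modulo the 7 printed citations (2 remaining named inputs: hLiu418 = `stmt-HodgeConjecture-24832`, h413 = `stmt-HodgeConjecture-24833`)
until rung 0 closes; count-neutral helper (local-field measure bookkeeping).

## References
* [Tate1950] J. Tate, *Fourier analysis in number fields and Hecke's zeta-functions* (1950), §2.2 Lemma 2.2.5, §2.3, §2.5 · [Weil1967] A. Weil, *Basic Number Theory* (1967), Ch. I §4.
-/

set_option autoImplicit false
set_option linter.dupNamespace false  -- the mandated namespace repeats the single-problem summit's segment (`HodgeConjecture.HodgeConjecture`)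

noncomputable section

open MeasureTheory Measure Set ValuativeRel
open scoped ENNReal NNReal Pointwise
open Literature.NumberTheory.Automorphic Literature.NumberTheory.Automorphic.LocalFieldHaar
open Literature.NumberTheory.GaloisRepresentations.IsNonarchimedeanLocalField

namespace Summit.HodgeConjecture.HodgeConjecture.Cruxes.H413.K2E3UnitFiltrationMeasure

variable {K : Type*} [Field K] [ValuativeRel K] [TopologicalSpace K] [IsNonarchimedeanLocalField K] [MeasurableSpace K] [BorelSpace K]

/-! ## §1 The model Haar measure `dx∕|x|` on subsets of the unit sphere; the two images -/

/-- **On the unit sphere `d×x = dx`**: for `T ⊆ {|a| = 1}` measurable, `(dx∕|x|)|_{Kˣ}(T) = μ(↑T)` (the density is `1` there). [cite: Tate1950, §2.2–§2.3] -/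
theorem unitsMeasure_apply_of_normAbs_eq_one (μ : Measure K) {T : Set Kˣ} (hTm : MeasurableSet T) (hT : ∀ a ∈ T, normAbs K (a : K) = 1) :
    Measure.comap ((↑) : Kˣ → K) (μ.withDensity fun x => (((normAbs K x)⁻¹ : ℝ≥0) : ℝ≥0∞)) T = μ (((↑) : Kˣ → K) '' T) := by
  have hme := measurableEmbedding_unitsVal (F := K)
  rw [hme.comap_apply, withDensity_apply _ (hme.measurableSet_image.2 hTm)]
  have h1 : ∀ x ∈ ((↑) : Kˣ → K) '' T, (((normAbs K x)⁻¹ : ℝ≥0) : ℝ≥0∞) = 1 := by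
    rintro x ⟨a, ha, rfl⟩
    rw [hT a ha, inv_one, ENNReal.coe_one]
  rw [setLIntegral_congr_fun (hme.measurableSet_image.2 hTm) h1, setLIntegral_one]

omit [MeasurableSpace K] [BorelSpace K] in
/-- `↑(U^{n+1}) ⊆ 1 + 𝔭ⁿ⁺¹` (`a ∈ U^{n+1} ⇒ a − 1 ∈ 𝔭ⁿ⁺¹`, ★ `mem_unitFiltration_iff_sub_one_mem`). [cite: Tate1950, §2.3] -/
theorem image_unitFiltration_succ_subset (n : ℕ) :
    ((↑) : Kˣ → K) '' unitFiltration K (n + 1) ⊆ (1 : K) +ᵥ primePowBall K ((n + 1 : ℕ) : ℤ) := by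
  rintro x ⟨a, ha, rfl⟩
  have h := (mem_unitFiltration_iff_sub_one_mem (by omega) a).1 ha
  exact ⟨(a : K) - 1, h, by simp [vadd_eq_add]⟩

omit [MeasurableSpace K] [BorelSpace K] in
/-- `𝒪 ∖ 𝔭 ⊆ ↑(𝒪^×)`: an element of the shell `{|x| ≤ 1} ∖ {|x| ≤ q⁻¹}` has `|x| = 1`, i.e. is a unit of valuation `1`. [cite: Tate1950, §2.5] -/
theorem shell_zero_subset_image_unitSphere :
    primePowBall K 0 \ primePowBall K 1 ⊆ ((↑) : Kˣ → K) '' {a : Kˣ | valuation K (a : K) = 1} := by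
  rintro x ⟨hx0, hx1⟩
  rw [mem_primePowBall_iff, zpow_zero] at hx0
  have hge : ¬ normAbs K x < ((residueFieldCard K : ℝ≥0)⁻¹) ^ (0 : ℤ) := by
    rw [normAbs_lt_zpow_iff, zero_add]
    rwa [mem_primePowBall_iff] at hx1
  rw [zpow_zero, not_lt] at hge
  have h1 : normAbs K x = 1 := le_antisymm hx0 hge
  have hx : x ≠ 0 := fun h => by rw [h, map_zero] at h1; exact zero_ne_one h1
  exact ⟨Units.mk0 x hx, by rw [mem_setOf_eq, Units.val_mk0, ← normAbs_eq_one_iff_valuation_eq_one, h1], rfl⟩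

/-! ## §2 Additive arithmetic: `μ(𝔭ⁿ⁺¹) = q⁻ⁿ μ(𝔭)` and `μ(𝔭) ≤ μ(𝒪 ∖ 𝔭)` -/

/-- `μ(𝔭ⁿ⁺¹) = q⁻ⁿ · μ(𝔭)` (iterate ★ `μ(𝔭ᵏ) = q μ(𝔭ᵏ⁺¹)`). [cite: Weil1967, Ch. I §4] [cite: Tate1950, §2.2 Lemma 2.2.5] -/
theorem measure_primePowBall_succ_eq (μ : Measure K) [μ.IsAddHaarMeasure] (n : ℕ) :
    μ (primePowBall K ((n + 1 : ℕ) : ℤ)) = ((residueFieldCard K : ℝ≥0∞)⁻¹) ^ n * μ (primePowBall K 1) := by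
  have hq0 : (residueFieldCard K : ℝ≥0∞) ≠ 0 := Nat.cast_ne_zero.2 (residueFieldCard_ne_zero K)
  have hqt : (residueFieldCard K : ℝ≥0∞) ≠ ⊤ := ENNReal.natCast_ne_top _
  induction n with
  | zero => simp
  | succ n ih =>
    have h := measure_primePowBall_eq_mul_succ μ (((n + 1 : ℕ) : ℤ))
    have h2 : μ (primePowBall K ((n + 1 + 1 : ℕ) : ℤ)) = (residueFieldCard K : ℝ≥0∞)⁻¹ * μ (primePowBall K ((n + 1 : ℕ) : ℤ)) := by
      rw [h, ← mul_assoc, ENNReal.inv_mul_cancel hq0 hqt, one_mul]; push_cast; ring_nf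
    rw [h2, ih, ← mul_assoc, pow_succ, mul_comm ((residueFieldCard K : ℝ≥0∞)⁻¹ ^ n)]

/-- `μ(𝔭) ≤ μ(𝒪 ∖ 𝔭)` (`μ(𝒪) = q μ(𝔭) = μ(𝒪 ∖ 𝔭) + μ(𝔭)` and `q ≥ 2`). [cite: Tate1950, §2.2 Lemma 2.2.5] -/
theorem measure_primePowBall_one_le_shell (μ : Measure K) [μ.IsAddHaarMeasure] :
    μ (primePowBall K 1) ≤ μ (primePowBall K 0 \ primePowBall K 1) := by
  have hsub : primePowBall K 1 ⊆ primePowBall K 0 := primePowBall_antitone (by omega)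
  have hfin : μ (primePowBall K 1) ≠ ⊤ := (measure_primePowBall_lt_top μ 1).ne
  have hO : μ (primePowBall K 0) = μ (primePowBall K 0 \ primePowBall K 1) + μ (primePowBall K 1) := by
    rw [← measure_union disjoint_sdiff_left (measurableSet_primePowBall 1), sdiff_union_of_subset hsub]
  have hq : μ (primePowBall K 0) = (residueFieldCard K : ℝ≥0∞) * μ (primePowBall K 1) := by
    have := measure_primePowBall_eq_mul_succ μ 0; rwa [zero_add] at this
  have h2 : (2 : ℝ≥0∞) ≤ residueFieldCard K := by exact_mod_cast (one_lt_residueFieldCard K)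
  have key : μ (primePowBall K 1) + μ (primePowBall K 1) ≤ μ (primePowBall K 0 \ primePowBall K 1) + μ (primePowBall K 1) := by
    calc μ (primePowBall K 1) + μ (primePowBall K 1) = 2 * μ (primePowBall K 1) := by rw [two_mul]
      _ ≤ (residueFieldCard K : ℝ≥0∞) * μ (primePowBall K 1) := mul_le_mul_left h2 _
      _ = _ := by rw [← hq, hO]
  exact (ENNReal.add_le_add_iff_right hfin).1 key

/-! ## §3 The head: `μ'(U^{n+1}) ≤ q⁻ⁿ μ'(𝒪^×)` for every Haar measure on `Kˣ` -/

omit [MeasurableSpace K] [BorelSpace K] in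
/-- `U^m ⊆ 𝒪^×` (the unit filtration lies in the unit sphere). [cite: Tate1950, §2.3] -/
theorem unitFiltration_subset_unitSphere (m : ℕ) : unitFiltration K m ⊆ {a : Kˣ | valuation K (a : K) = 1} :=
  fun a ha => by rw [mem_setOf_eq, ← normAbs_eq_one_iff_valuation_eq_one]; exact ha.1

/-- **THE HAAR MASS OF THE UNIT FILTRATION**: for EVERY Haar measure `μ'` on `Kˣ` and every `n`, `μ'(U^{n+1}) ≤ q⁻ⁿ · μ'(𝒪^×)` — the index bound
`[𝒪^× : 1 + 𝔭ⁿ⁺¹] ≥ qⁿ` in measure form (sharp: `(q−1)qⁿ`), which turns «the event is one coset of `1 + 𝔭ᵐ`» into the digit-fibre bounds `≤ C r` of road FC.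
Proof: `μ' = c·(dx∕|x|)|_{Kˣ}` (Mathlib Haar uniqueness, ★ `isHaarMeasure_unitsMeasure`), `= c·dx` on the unit sphere (§1), and §2.
[cite: Tate1950, §2.2 Lemma 2.2.5, §2.3, §2.5] [cite: Weil1967, Ch. I §4] -/
theorem measure_unitFiltration_succ_le (μ' : Measure Kˣ) [μ'.IsHaarMeasure] (n : ℕ) :
    μ' (unitFiltration K (n + 1)) ≤ ((residueFieldCard K : ℝ≥0∞)⁻¹) ^ n * μ' {a : Kˣ | valuation K (a : K) = 1} := by
  haveI : T2Space K := (Literature.NumberTheory.GaloisRepresentations.IsNonarchimedeanLocalField.isLocalField K).toT2Space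
  haveI : BorelSpace Kˣ := Units.borelSpace
  haveI : LocallyCompactSpace Kˣ := (isOpenEmbedding_unitsVal (F := K)).locallyCompactSpace
  haveI : SecondCountableTopology Kˣ := secondCountableTopology_units K
  set μ : Measure K := Measure.addHaar with hμ
  set ν : Measure Kˣ := Measure.comap ((↑) : Kˣ → K) (μ.withDensity fun x => (((normAbs K x)⁻¹ : ℝ≥0) : ℝ≥0∞)) with hν
  haveI : ν.IsHaarMeasure := isHaarMeasure_unitsMeasure μ
  -- Haar uniqueness on `Kˣ`
  have hμ' : μ' = μ'.haarScalarFactor ν • ν := Measure.isMulLeftInvariant_eq_smul μ' ν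
  have happ : ∀ T : Set Kˣ, μ' T = μ'.haarScalarFactor ν * ν T := fun T => by
    conv_lhs => rw [hμ']
    rfl
  -- the two sets on the unit sphere
  have hUm : MeasurableSet (unitFiltration K (n + 1)) := (isOpen_unitFiltration (by omega)).measurableSet
  have hSm : MeasurableSet {a : Kˣ | valuation K (a : K) = 1} := isOpen_units_valuation_eq_one.measurableSet
  have hU : ν (unitFiltration K (n + 1)) ≤ ((residueFieldCard K : ℝ≥0∞)⁻¹) ^ n * μ (primePowBall K 1) := by
    rw [hν, unitsMeasure_apply_of_normAbs_eq_one μ hUm (fun a ha => ha.1)]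
    calc μ (((↑) : Kˣ → K) '' unitFiltration K (n + 1)) ≤ μ ((1 : K) +ᵥ primePowBall K ((n + 1 : ℕ) : ℤ)) := measure_mono (image_unitFiltration_succ_subset n)
      _ = μ (primePowBall K ((n + 1 : ℕ) : ℤ)) := measure_vadd μ (1 : K) _
      _ = ((residueFieldCard K : ℝ≥0∞)⁻¹) ^ n * μ (primePowBall K 1) := measure_primePowBall_succ_eq μ n
  have hS : μ (primePowBall K 1) ≤ ν {a : Kˣ | valuation K (a : K) = 1} := by
    rw [hν, unitsMeasure_apply_of_normAbs_eq_one μ hSm (fun a ha => (normAbs_eq_one_iff_valuation_eq_one).2 ha)]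
    exact (measure_primePowBall_one_le_shell μ).trans (measure_mono shell_zero_subset_image_unitSphere)
  rw [happ, happ]
  calc μ'.haarScalarFactor ν * ν (unitFiltration K (n + 1)) ≤ μ'.haarScalarFactor ν * (((residueFieldCard K : ℝ≥0∞)⁻¹) ^ n * μ (primePowBall K 1)) := by gcongr
    _ ≤ μ'.haarScalarFactor ν * (((residueFieldCard K : ℝ≥0∞)⁻¹) ^ n * ν {a : Kˣ | valuation K (a : K) = 1}) := by gcongr
    _ = ((residueFieldCard K : ℝ≥0∞)⁻¹) ^ n * (μ'.haarScalarFactor ν * ν {a : Kˣ | valuation K (a : K) = 1}) := by ring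

/-- **Coset form** (what road FC consumes): for every `a₀ ∈ Kˣ`, `μ'(a₀·U^{n+1}) ≤ q⁻ⁿ · μ'(𝒪^×)` (left invariance of `μ'`). [cite: Tate1950, §2.3, §2.5] -/
theorem measure_smul_unitFiltration_succ_le (μ' : Measure Kˣ) [μ'.IsHaarMeasure] (a₀ : Kˣ) (n : ℕ) :
    μ' (a₀ • unitFiltration K (n + 1)) ≤ ((residueFieldCard K : ℝ≥0∞)⁻¹) ^ n * μ' {a : Kˣ | valuation K (a : K) = 1} := by
  rw [measure_smul]
  exact measure_unitFiltration_succ_le μ' n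

end Summit.HodgeConjecture.HodgeConjecture.Cruxes.H413.K2E3UnitFiltrationMeasure

end
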